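import Literature.NumberTheory.EllipticCurves.HeegnerPointsKolyvaginConjugation
import Literature.NumberTheory.EllipticCurves.GaloisActionProofs
import HarnessLib

/-!
# Route `CMKolyvaginAtInertTwo`, crux `CMKolyvaginExactAtInertTwo` (stmt-BirchSwinnertonDyer-24277):
# GROSS'S PROP. 9.1 AT `p = 2` — `H¹(K, E[2]) → Hom(Γ_{K(E[2])}, E[2])` is injective when
# `ρ̄_{E,2}` is onto, for every quadratic `K` (the order-`3` element replaces the homothety `−1`)

Seat `bsd-line-cmk2-p1` g3 (cell `bsd-print-cf2`); helper (`--supports stmt-BirchSwinnertonDyer-24277`;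
equally serves route GenusKolyvaginAtTwo's 22137). THEOREMS ONLY: no definition, no named fact, no `sorry`; no item is closed; BSD is not proved by any of this.

WHY. Every Kolyvagin argument starts from the injectivity of restriction
`H¹(K, E_p) ↪ H¹(K(E_p), E_p) = Hom(Gal(ℚ̄/K(E_p)), E_p)` (Gross 1991, Prop. 9.1; McCallum 1991,
(2)). The tree's kernel form is `eq_zero_of_h1Eval_eq_zero` (`HeegnerPointsKolyvaginPairing`):
*some `z ∈ Γ_K` acts on `E[n]` as `−1` and `2` is invertible on `E[n]`* — Serre's proof through the
central homothety `−1 ∈ Z ≃ (ℤ/p)ˣ`, which is EMPTY at `p = 2` (`−1 = 1`, `Z = 1`: DOSSIER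
§20.1 row X13, memo `Cruxes/CMExactDescentAtTwo/MEMO-tau-line-at-two.md` §4 (P1)). At `p = 2`
with `ρ̄_{E,2}` onto (`Gal(ℚ(E[2])/ℚ) ≅ GL₂(𝔽₂) ≅ S₃`) the substitute is the element of ORDER `3`
(Lawson–Wuthrich 2016, Lemma 6: `H¹(GL₂(𝔽₂); 𝔽₂²) = 0`): it lies in `ρ̄(Γ_K)` for every
quadratic `K` (`ρ̄(Γ_K) ⊇ ρ̄(Γ_ℚ)² ∋` the square of a `3`-cycle), acts on `E[2]` without
non-zero fixed points, and its `Γ_K`-conjugates act as `z^{±1}`. This file proves Prop. 9.1 at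
`2` from that element, in the machine's own vocabulary (`galH1Torsion`, `h1Eval`,
`torsionFixing`), so that a `p = 2` port of the Čebotarev leaf can quote it.

* §1 (pure algebra of a `4`-group `T = {0, a, b, a+b}`): `mem_four`; a fixed-point-free
  automorphism `f` has `f(f a) = a + f a` (`apply_apply_eq_add_of_fixedPointFree`); two
  fixed-point-free automorphisms `σ, z` satisfy `σ = z` or `σ = z²` (`eq_or_eq_sq_of_fixedPointFree`);
  from `hsq : G` realises every square of `Aut T` (the tree's hypothesis of `KolyvaginImage.*`),
  some `z ∈ G` acts with `z³ = 1` and no non-zero fixed point (`exists_smul_three`, via the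
  `3`-cycle `(x, y) ↦ (y, x + y) = shearX 1 ∘ shearY 1` of `(ℤ/2)²`).
* §2 (cohomology, any level `n`, any field): `eq_zero_of_h1Eval_eq_zero_of_three` — if `z ∈ Γ_K`
  acts on `E[n]` without non-zero fixed points, `E[n]` is finite, and every conjugate `g⁻¹zg`
  acts as `z` or `z²`, then a class `x ∈ H¹(K, E[n])` with `[x, ρ] = 0` for all
  `ρ ∈ Γ_{K(E[n])}` is `0`. (Cocycle proof: `z − 1` is bijective on `E[n]`, so after a coboundary
  the cocycle `ψ` vanishes at `z`, on `Γ_{K(E[n])}`, hence at every conjugate `z' = g⁻¹zg`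
  (`= z^{±1}·n₀`); then `ψ(zg) = zψ(g)` and `ψ(g z') = ψ(g)` give `(z−1)ψ(g) = 0`.)
* §3 (level `2`): `eq_zero_of_h1Eval_eq_zero_two` (conjugates automatic from `#E[2] = 4`) and
  **`h1_restriction_injective_two`: for `W/ℚ` with `ρ̄_{W,2}` onto and `[K:ℚ] = 2`, every
  `x ∈ H¹(K, E[2])` vanishing on `Γ_{K(E[2])}` is `0`** (`z` from
  `RatClosure.exists_smul_eq_of_sq` + `KolyvaginImage.nonempty_addEquiv_of_card_eq_sq`).

References: [GrossLMS1991] §9 Prop. 9.1; [McCallumLMS1991] §3 (2); [LawsonWuthrich2016] Lemma 6;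
[SerreGaloisCohomology1997] I.§2.2, I.§5.1.
-/

-- single-conjunct summit: `Summit.BirchSwinnertonDyer.BirchSwinnertonDyer.…` repeats the name by design
set_option linter.dupNamespace false
set_option autoImplicit false

noncomputable section

open scoped Classical

namespace Summit.BirchSwinnertonDyer.BirchSwinnertonDyer.Theorems.KolyvaginImageTwo

open WeierstrassCurve Field
open Literature.NumberTheory.EllipticCurves Literature.NumberTheory.GaloisRepresentations

universe u

/-! ## §1 The `4`-group and its fixed-point-free automorphisms -/

section FourGroup

variable {T : Type*} [AddCommGroup T]

/-- **`T = {0, a, b, a + b}`**: in an abelian group of exponent `2` with exactly `4` elements, any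
non-zero `a` and any `b ∉ {0, a}` list all elements. [folklore] -/
theorem mem_four (h2 : ∀ t : T, t + t = 0) (hcard : Nat.card T = 4) {a b : T} (ha : a ≠ 0)
    (hb : b ≠ 0) (hba : b ≠ a) (t : T) : t = 0 ∨ t = a ∨ t = b ∨ t = a + b := by
  haveI : Finite T := Nat.finite_of_card_ne_zero (by rw [hcard]; norm_num)
  letI := Fintype.ofFinite T
  have hneg : ∀ t : T, -t = t := fun t ↦ neg_eq_of_add_eq_zero_left (h2 t)
  have hab0 : a + b ≠ 0 := fun h ↦ hba (by rw [eq_neg_of_add_eq_zero_right h, hneg])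
  have haba : a + b ≠ a := fun h ↦ hb (by simpa using h)
  have habb : a + b ≠ b := fun h ↦ ha (by simpa using h)
  set S : Finset T := {0, a, b, a + b} with hS
  have hScard : S.card = 4 := by
    rw [hS, Finset.card_insert_of_notMem, Finset.card_insert_of_notMem,
      Finset.card_insert_of_notMem, Finset.card_singleton]
    · simpa using habb.symm
    · simp only [Finset.mem_insert, Finset.mem_singleton, not_or]; exact ⟨hba.symm, haba.symm⟩
    · simp only [Finset.mem_insert, Finset.mem_singleton, not_or]; exact ⟨ha.symm, hb.symm, hab0.symm⟩
  have hSuniv : S = Finset.univ :=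
    Finset.eq_univ_of_card S (by rw [hScard, ← Nat.card_eq_fintype_card, hcard])
  have ht : t ∈ S := by rw [hSuniv]; exact Finset.mem_univ t
  simpa [hS] using ht

/-- **A fixed-point-free automorphism `f` of the `4`-group**: for `a ≠ 0`, `f a ∉ {0, a}` and
`f (f a) = a + f a` (so `f` is one of the two `3`-cycles of `T ∖ 0`). [folklore] -/
theorem apply_apply_eq_add_of_fixedPointFree (h2 : ∀ t : T, t + t = 0) (hcard : Nat.card T = 4)
    (f : T ≃+ T) (hf : ∀ t, f t = t → t = 0) {a : T} (ha : a ≠ 0) :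
    f a ≠ 0 ∧ f a ≠ a ∧ f (f a) = a + f a := by
  have hneg : ∀ t : T, -t = t := fun t ↦ neg_eq_of_add_eq_zero_left (h2 t)
  have hfa0 : f a ≠ 0 := fun h ↦ ha ((EmbeddingLike.map_eq_zero_iff (f := f)).mp h)
  have hfaa : f a ≠ a := fun h ↦ ha (hf a h)
  refine ⟨hfa0, hfaa, ?_⟩
  rcases mem_four h2 hcard ha hfa0 hfaa (f (f a)) with h | h | h | h
  · exact absurd ((EmbeddingLike.map_eq_zero_iff (f := f)).mp h) hfa0
  · exfalso
    have hfix : f (a + f a) = a + f a := by rw [map_add, h, add_comm]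
    have h0 : a + f a = 0 := hf _ hfix
    exact hfaa (by rw [eq_neg_of_add_eq_zero_right h0, hneg])
  · exact absurd (f.injective h) hfaa
  · exact h

/-- **Two fixed-point-free automorphisms of the `4`-group coincide or are each other's square**
(the `3`-cycles of `S₃`). [folklore] -/
theorem eq_or_eq_sq_of_fixedPointFree (h2 : ∀ t : T, t + t = 0) (hcard : Nat.card T = 4)
    (σ z : T ≃+ T) (hσ : ∀ t, σ t = t → t = 0) (hz : ∀ t, z t = t → t = 0) :
    (∀ t, σ t = z t) ∨ (∀ t, σ t = z (z t)) := by
  -- a non-zero element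
  obtain ⟨a, ha⟩ : ∃ a : T, a ≠ 0 := by
    by_contra h
    push Not at h
    haveI : Subsingleton T := ⟨fun x y ↦ by rw [h x, h y]⟩
    have h1 : Nat.card T = 1 := Nat.card_of_subsingleton (0 : T)
    omega
  -- two fixed-point-free automorphisms agreeing at `a` agree everywhere
  have key : ∀ (f g : T ≃+ T), (∀ t, f t = t → t = 0) → (∀ t, g t = t → t = 0) → f a = g a →
      ∀ t, f t = g t := by
    intro f g hf hg hfg t
    obtain ⟨_, _, hffa⟩ := apply_apply_eq_add_of_fixedPointFree h2 hcard f hf ha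
    obtain ⟨hga0, hgaa, hgga⟩ := apply_apply_eq_add_of_fixedPointFree h2 hcard g hg ha
    have hfga : f (g a) = g (g a) := by rw [← hfg, hffa, hfg, hgga]
    rcases mem_four h2 hcard ha hga0 hgaa t with rfl | rfl | rfl | rfl
    · rw [map_zero, map_zero]
    · exact hfg
    · exact hfga
    · rw [map_add, map_add, hfga, hfg]
  obtain ⟨hza0, hzaa, hzza⟩ := apply_apply_eq_add_of_fixedPointFree h2 hcard z hz ha
  obtain ⟨hσa0, hσaa, -⟩ := apply_apply_eq_add_of_fixedPointFree h2 hcard σ hσ ha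
  rcases mem_four h2 hcard ha hza0 hzaa (σ a) with h | h | h | h
  · exact absurd h hσa0
  · exact absurd h hσaa
  · exact Or.inl (key σ z hσ hz h)
  · right
    -- `z²` is fixed-point-free too: `z (z t) = t + z t ≠ t` for `t ≠ 0`
    have hz2 : ∀ t, (z.trans z) t = t → t = 0 := by
      intro t ht
      by_contra ht0
      obtain ⟨hzt0, -, hzzt⟩ := apply_apply_eq_add_of_fixedPointFree h2 hcard z hz ht0
      rw [AddEquiv.trans_apply, hzzt] at ht
      exact hzt0 (by simpa using ht)
    have hσz2 : σ a = (z.trans z) a := by rw [AddEquiv.trans_apply, hzza]; exact h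
    intro t
    rw [key σ (z.trans z) hσ hz2 hσz2 t, AddEquiv.trans_apply]

end FourGroup

/-! ### The element of order `3` from the squares hypothesis -/

section Squares

variable {G : Type*} [Group G] {T : Type*} [AddCommGroup T] [DistribMulAction G T]

/-- `2 = 0` in `ℤ/2`. [folklore] -/
private theorem add_self_zmod_two (y : ZMod 2) : y + y = 0 := by
  have h : (2 : ZMod 2) = 0 := by decide
  rw [← two_mul, h, zero_mul]

/-- **Some element of `G` acts on `T` with order `3` and no non-zero fixed point** when `G`
realises every square of an automorphism of `T ≃ (ℤ/2)²` (the hypothesis of the tree's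
`KolyvaginImage.*`, satisfied by `Γ_K` for a quadratic `K` when `ρ̄_{E,2}` is onto): the square
of the `3`-cycle `R = (x, y) ↦ (y, x + y)` (`= shearX 1 ∘ shearY 1` in characteristic `2`) is
again a `3`-cycle. The `p = 2` substitute for `KolyvaginImage.exists_smul_eq_neg` (the homothety
`−1`, trivial at `2`). [cite: LawsonWuthrich2016, Lemma 6] [cite: GrossLMS1991, §9 (before Prop. 9.1)] -/
theorem exists_smul_three (e : T ≃+ (Fin 2 → ZMod 2))
    (hsq : ∀ A : T ≃+ T, ∃ g : G, ∀ t, g • t = A (A t)) :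
    ∃ z : G, (∀ t : T, z • z • z • t = t) ∧ (∀ t : T, z • t = t → t = 0) := by
  let R : (Fin 2 → ZMod 2) ≃+ (Fin 2 → ZMod 2) :=
    (KolyvaginImage.shearY (1 : ZMod 2)).trans (KolyvaginImage.shearX 1)
  have hR0 : ∀ v, R v 0 = v 1 := fun v ↦ by
    have h : R v 0 = v 0 + 1 * (v 1 + 1 * v 0) := rfl
    rw [h]
    linear_combination add_self_zmod_two (v 0)
  have hR1 : ∀ v, R v 1 = v 0 + v 1 := fun v ↦ by
    have h : R v 1 = v 1 + 1 * v 0 := rfl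
    rw [h]; ring
  -- `R³ = 1`
  have hR3 : ∀ v, R (R (R v)) = v := fun v ↦ by
    ext i; fin_cases i
    · show R (R (R v)) 0 = v 0
      rw [hR0, hR1, hR0, hR1]
      linear_combination add_self_zmod_two (v 1)
    · show R (R (R v)) 1 = v 1
      rw [hR1, hR0, hR1, hR1, hR0, hR1]
      linear_combination add_self_zmod_two (v 0) + add_self_zmod_two (v 1)
  -- `R²` has no non-zero fixed vector
  have hRfix : ∀ v, R (R v) = v → v = 0 := fun v h ↦ by
    have h0 := congrFun h 0
    have h1 := congrFun h 1
    rw [hR0, hR1] at h0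
    rw [hR1, hR0, hR1] at h1
    -- `h0 : v 0 + v 1 = v 0`, `h1 : v 1 + (v 0 + v 1) = v 1`
    have hv1 : v 1 = 0 := by simpa using h0
    have hv0 : v 0 = 0 := by rw [hv1, add_zero] at h1; simpa using h1
    ext i; fin_cases i
    · simpa using hv0
    · simpa using hv1
  obtain ⟨z, hz⟩ := hsq (KolyvaginImage.transport e R)
  have hz' : ∀ t, z • t = e.symm (R (R (e t))) := fun t ↦ by
    rw [hz, KolyvaginImage.transport_apply, KolyvaginImage.transport_apply, AddEquiv.apply_symm_apply]
  refine ⟨z, fun t ↦ ?_, fun t ht ↦ ?_⟩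
  · rw [hz' t, hz', hz', AddEquiv.apply_symm_apply, AddEquiv.apply_symm_apply, hR3, hR3,
      AddEquiv.symm_apply_apply]
  · rw [hz'] at ht
    have h' : R (R (e t)) = e t := by
      have := congrArg e ht
      rwa [AddEquiv.apply_symm_apply] at this
    exact (EmbeddingLike.map_eq_zero_iff (f := e)).mp (hRfix (e t) h')

end Squares

/-! ## §2 Gross's Prop. 9.1 from an element acting without fixed points whose conjugates are its powers -/

section Cohomology

variable {K : Type u} [Field K] (W : WeierstrassCurve K) (n : ℤ)

/-- **Injectivity of restriction `H¹(K, E[n]) → Hom(Γ_{K(E[n])}, E[n])` from an element of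
"order-`3` type"** (the `p = 2` substitute for `eq_zero_of_h1Eval_eq_zero`, whose homothety `−1`
is trivial at `2`). If `z ∈ Γ_K` acts on the finite module `E[n] = E(K̄)[n]` WITHOUT non-zero fixed
points and every conjugate `g⁻¹ z g` acts as `z` or as `z²`, then a class `x` with `[x, ρ] = 0`
for all `ρ ∈ Γ_{K(E[n])}` vanishes. Proof on a cocycle `φ` of `x` (vanishing on `Γ_{K(E[n])}`):
`z − 1` is a bijection of `E[n]`, so `φ(z) = zb − b`; `ψ = φ − ∂b` vanishes at `z`, on
`Γ_{K(E[n])}`, hence at every conjugate `z' = g⁻¹zg = z^{1 or 2}·n₀`; comparing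
`ψ(zg) = zψ(g)` with `ψ(gz') = ψ(g)` gives `zψ(g) = ψ(g)`, so `ψ(g) = 0` and `φ = ∂b`.
[cite: GrossLMS1991, §9 Prop. 9.1] [cite: LawsonWuthrich2016, Lemma 6] -/
theorem eq_zero_of_h1Eval_eq_zero_of_three [Finite (geomTorsion W n)] {z : absoluteGaloisGroup K}
    (hzfix : ∀ P : geomTorsion W n, z • P = P → P = 0)
    (hconj : ∀ g : absoluteGaloisGroup K,
      (∀ P : geomTorsion W n, (g⁻¹ * z * g) • P = z • P) ∨
      (∀ P : geomTorsion W n, (g⁻¹ * z * g) • P = z • z • P))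
    {x : galH1Torsion W n} (hx : ∀ ρ ∈ torsionFixing W n, h1Eval W n x ρ = 0) : x = 0 := by
  rw [← oneCocycleClass_reprCocycle W n x]
  set φ := reprCocycle W n x with hφ
  have hφN : ∀ ρ ∈ torsionFixing W n, φ.1 ρ = 0 := hx
  -- `P ↦ z • P - P` is a bijection of the finite set `E[n]`
  have hinj : Function.Injective (fun P : geomTorsion W n ↦ z • P - P) := by
    intro P Q h
    have h' : z • (P - Q) = P - Q := by
      rw [smul_sub]
      have e : z • P - z • Q - (P - Q) = (z • P - P) - (z • Q - Q) := by abel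
      rw [← sub_eq_zero, e, sub_eq_zero]
      exact h
    exact sub_eq_zero.mp (hzfix _ h')
  obtain ⟨b, hb⟩ := Finite.surjective_of_injective hinj (φ.1 z)
  -- `hb : z • b - b = φ z`; we show `φ = ∂b`
  refine (oneCocycleClass_eq_zero_iff _ φ).mpr ⟨b, fun g ↦ ?_⟩
  rw [discreteTopRep_ρ_apply]
  set ψ : absoluteGaloisGroup K → geomTorsion W n := fun g ↦ φ.1 g - (g • b - b) with hψ
  have hcoc : ∀ g h : absoluteGaloisGroup K, ψ (g * h) = ψ g + g • ψ h := by
    intro g h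
    have hgh := φ.2 g h
    rw [discreteTopRep_ρ_apply] at hgh
    simp only [hψ, hgh, mul_smul, smul_sub]
    abel
  have hψz : ψ z = 0 := by
    simp only [hψ, ← hb, sub_self]
  have hψN : ∀ ρ ∈ torsionFixing W n, ψ ρ = 0 := fun ρ hρ ↦ by
    simp only [hψ, hφN ρ hρ, smul_eq_of_mem_torsionFixing W n hρ, sub_self]
  have hψzz : ψ (z * z) = 0 := by rw [hcoc, hψz, smul_zero, add_zero]
  suffices hall : ∀ g, ψ g = 0 by
    have := hall g
    simp only [hψ] at this
    exact sub_eq_zero.mp this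
  intro g
  -- the conjugate `z' = g⁻¹ z g` is `z · n₀` or `z² · n₀` with `n₀ ∈ Γ_{K(E[n])}`
  have hψz' : ψ (g⁻¹ * z * g) = 0 := by
    rcases hconj g with h | h
    · have hn₀ : z⁻¹ * (g⁻¹ * z * g) ∈ torsionFixing W n :=
        (mem_torsionFixing_iff W n).mpr fun P ↦ by rw [mul_smul, h, inv_smul_smul]
      have e : g⁻¹ * z * g = z * (z⁻¹ * (g⁻¹ * z * g)) := by group
      rw [e, hcoc, hψz, hψN _ hn₀, smul_zero, add_zero]
    · have hn₀ : (z * z)⁻¹ * (g⁻¹ * z * g) ∈ torsionFixing W n :=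
        (mem_torsionFixing_iff W n).mpr fun P ↦ by rw [mul_smul, h, ← mul_smul z z P, inv_smul_smul]
      have e : g⁻¹ * z * g = (z * z) * ((z * z)⁻¹ * (g⁻¹ * z * g)) := by group
      rw [e, hcoc, hψzz, hψN _ hn₀, smul_zero, add_zero]
  have h1 : ψ (z * g) = z • ψ g := by rw [hcoc, hψz, zero_add]
  have h2 : ψ (g * (g⁻¹ * z * g)) = ψ g := by rw [hcoc, hψz', smul_zero, add_zero]
  have h3 : g * (g⁻¹ * z * g) = z * g := by group
  rw [h3, h1] at h2
  exact hzfix _ h2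

/-! ## §3 Level `2`: the conjugates are automatic, and `z` exists for a quadratic `K` -/

/-- **Prop. 9.1 at level `2`**: if `#E[2] = 4` and some `z ∈ Γ_K` acts on `E[2]` without non-zero
fixed points, then restriction `H¹(K, E[2]) → Hom(Γ_{K(E[2])}, E[2])` is injective (every
conjugate of `z` is again fixed-point-free, hence acts as `z` or `z²` by §1).
[cite: GrossLMS1991, §9 Prop. 9.1] [cite: LawsonWuthrich2016, Lemma 6] -/
theorem eq_zero_of_h1Eval_eq_zero_two (hcard : Nat.card (geomTorsion W ((2 : ℕ) : ℤ)) = 4)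
    {z : absoluteGaloisGroup K} (hzfix : ∀ P : geomTorsion W ((2 : ℕ) : ℤ), z • P = P → P = 0)
    {x : galH1Torsion W ((2 : ℕ) : ℤ)}
    (hx : ∀ ρ ∈ torsionFixing W ((2 : ℕ) : ℤ), h1Eval W ((2 : ℕ) : ℤ) x ρ = 0) : x = 0 := by
  haveI : Finite (geomTorsion W ((2 : ℕ) : ℤ)) := Nat.finite_of_card_ne_zero (by rw [hcard]; norm_num)
  have h2 : ∀ t : geomTorsion W ((2 : ℕ) : ℤ), t + t = 0 := fun t ↦ by
    have := AddSubgroup.torsionBy.nsmul t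
    rwa [two_nsmul] at this
  refine eq_zero_of_h1Eval_eq_zero_of_three W _ hzfix (fun g ↦ ?_) hx
  let zA : geomTorsion W ((2 : ℕ) : ℤ) ≃+ geomTorsion W ((2 : ℕ) : ℤ) :=
    DistribMulAction.toAddEquiv _ z
  let σA : geomTorsion W ((2 : ℕ) : ℤ) ≃+ geomTorsion W ((2 : ℕ) : ℤ) :=
    DistribMulAction.toAddEquiv _ (g⁻¹ * z * g)
  have hzA : ∀ t, zA t = z • t := fun _ ↦ rfl
  have hσA : ∀ t, σA t = (g⁻¹ * z * g) • t := fun _ ↦ rfl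
  have hσfix : ∀ t, σA t = t → t = 0 := fun t ht ↦ by
    rw [hσA, mul_smul, mul_smul] at ht
    -- `g⁻¹ • z • g • t = t` ⟹ `z • (g • t) = g • t` ⟹ `g • t = 0` ⟹ `t = 0`
    have h' : z • g • t = g • t := by
      have := congrArg (g • ·) ht
      simpa only [smul_inv_smul] using this
    have hg0 : g • t = 0 := hzfix _ h'
    have := congrArg (g⁻¹ • ·) hg0
    simpa only [inv_smul_smul, smul_zero] using this
  rcases eq_or_eq_sq_of_fixedPointFree h2 hcard σA zA hσfix (fun t ht ↦ hzfix t ht) with h | h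
  · exact Or.inl fun P ↦ by rw [← hσA, h P, hzA]
  · exact Or.inr fun P ↦ by rw [← hσA, h P, hzA, hzA]

/-- **An element of `Γ_K` acting on `E[2]` with order `3` and no non-zero fixed point**, for
`W/ℚ` with `ρ̄_{W,2}` onto and `K` quadratic: `ρ̄(Γ_K)` contains all squares of `Aut E[2] ≅ S₃`
(`RatClosure.exists_smul_eq_of_sq`), in particular the square of a `3`-cycle. The `p = 2`
substitute for the homothety `−1 ∈ ρ̄(Γ_K)`. [cite: GrossLMS1991, §9 (before Prop. 9.1)]
[cite: LawsonWuthrich2016, Lemma 6] -/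
theorem exists_smul_three_of_hasSurjectiveModNGaloisRep (W : WeierstrassCurve ℚ) [W.IsElliptic]
    (K : Type) [Field K] [NumberField K] (hK2 : Module.finrank ℚ K = 2)
    (hsurj : W.HasSurjectiveModNGaloisRep 2) :
    ∃ z : absoluteGaloisGroup K,
      (∀ P : geomTorsion (W.baseChange K) ((2 : ℕ) : ℤ), z • z • z • P = P) ∧
      (∀ P : geomTorsion (W.baseChange K) ((2 : ℕ) : ℤ), z • P = P → P = 0) := by
  haveI : (W.baseChange K).IsElliptic := by rw [baseChange]; infer_instance
  have hT : ∀ P : geomTorsion (W.baseChange K) ((2 : ℕ) : ℤ), 2 • P = 0 := fun P ↦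
    AddSubgroup.torsionBy.nsmul P
  have hcard : Nat.card (geomTorsion (W.baseChange K) ((2 : ℕ) : ℤ)) = 2 ^ 2 :=
    card_torsionPoints_eq_sq_holds (W.baseChange K) (AlgebraicClosure K) (n := 2) (by norm_num)
  obtain ⟨eT⟩ := KolyvaginImage.nonempty_addEquiv_of_card_eq_sq hT hcard
  have hsurj' : W.HasSurjectiveModNGaloisRep ((2 : ℕ) : ℤ) := by simpa using hsurj
  have hsq := RatClosure.exists_smul_eq_of_sq (K := K) W hK2 (n := ((2 : ℕ) : ℤ)) hsurj'
  exact exists_smul_three eT hsq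

/-- **`#E(K̄)[2] = 4`.** [cite: SilvermanAEC2009, Cor. III.6.4(b)] -/
theorem natCard_geomTorsion_two (W : WeierstrassCurve ℚ) [W.IsElliptic]
    (K : Type) [Field K] [NumberField K] :
    Nat.card (geomTorsion (W.baseChange K) ((2 : ℕ) : ℤ)) = 4 := by
  haveI : (W.baseChange K).IsElliptic := by rw [baseChange]; infer_instance
  have h : Nat.card (geomTorsion (W.baseChange K) ((2 : ℕ) : ℤ)) = 2 ^ 2 :=
    card_torsionPoints_eq_sq_holds (W.baseChange K) (AlgebraicClosure K) (n := 2) (by norm_num)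
  rw [h]; norm_num

/-- **GROSS'S PROP. 9.1 AT `p = 2` (Lawson–Wuthrich Lemma 6 in the machine's form): restriction
`H¹(K, E[2]) → Hom(Γ_{K(E[2])}, E[2])` is injective** for every `W/ℚ` with `ρ̄_{W,2}` onto and
every quadratic `K`: if `[x, ρ] = 0` for all `ρ ∈ Γ_{K(E[2])}` then `x = 0`. Equivalently
`H¹(Gal(K(E[2])/K), E[2]) = 0`. On the habitat H₂ of route CMKolyvaginAtInertTwo (`ρ̄₂` onto) and on
route GenusKolyvaginAtTwo's habitat this is the input «(P1) vanishing of `H¹(Gal(L_M/K), E[2^M])`»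
of the memo at `M = 1`. [cite: GrossLMS1991, §9 Prop. 9.1] [cite: LawsonWuthrich2016, Lemma 6]
[cite: McCallumLMS1991, §3 (2)] -/
theorem h1_restriction_injective_two (W : WeierstrassCurve ℚ) [W.IsElliptic]
    (K : Type) [Field K] [NumberField K] (hK2 : Module.finrank ℚ K = 2)
    (hsurj : W.HasSurjectiveModNGaloisRep 2) {x : galH1Torsion (W.baseChange K) ((2 : ℕ) : ℤ)}
    (hx : ∀ ρ ∈ torsionFixing (W.baseChange K) ((2 : ℕ) : ℤ),
      h1Eval (W.baseChange K) ((2 : ℕ) : ℤ) x ρ = 0) : x = 0 := by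
  obtain ⟨z, -, hzfix⟩ := exists_smul_three_of_hasSurjectiveModNGaloisRep W K hK2 hsurj
  exact eq_zero_of_h1Eval_eq_zero_two (W.baseChange K) (natCard_geomTorsion_two W K) hzfix hx

end Cohomology

end Summit.BirchSwinnertonDyer.BirchSwinnertonDyer.Theorems.KolyvaginImageTwo

end
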